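import Literature.NumberTheory.DiophantineGeometry.FunctionFieldResidueTrace
import Literature.NumberTheory.DiophantineGeometry.FunctionFieldArtinSchreierIrreducible
import HarnessLib

/-!
# Upper bounds on the divisor of `dy` from non-vanishing residues (any place, any characteristic)

Topic: `Literature/NumberTheory/DiophantineGeometry`. Continuation of `FunctionFieldResidues` (Tate's
residues `res_P(f dg) = PlaceOver.localRes`, the Weil differential `dy = dOf K y`, the divisor
`(ω) = differentialDivisor ω`) and `FunctionFieldResidueTrace` (the trace formula
`res_P(a g⁻¹ dg) = v_P(g) Tr_{F_P/K}(a(P))` at an arbitrary place). Those files COMPUTE `(dy)_P`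
only at rational places in the tame case; here we record the tools that BOUND `(dy)_P` from above at
any place, in any characteristic:

* `PlaceOver.exists_localRes_mul_inv_ne_zero` — over a finite (perfect) constant field and for a
  local parameter `t`, `res_P(h t⁻¹ dt) = Tr_{F_P/K}(h̄) ≠ 0` for some unit `h` (the trace form of
  the separable extension `F_P/K` is non-degenerate);
* `PlaceOver.differentialDivisor_le_of_localRes_ne_zero` — `res_P(a dy) ≠ 0 ⇒ dy ≠ 0 ∧
  (dy)_P ≤ -v_P(a) - 1` (definition of `(dy)`: `dy` kills `𝒜((dy))`, Stichtenoth Def. 1.5.11);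
* `PlaceOver.differentialDivisor_dOf_le_ord` — **the local bound**: if at `P` "`dy = c dt`" in the
  sense of residues (`res_P(a dy) = res_P(a c dt)` for all `a`) with `t` a local parameter and
  `c ≠ 0`, then `dy ≠ 0` and `(dy)_P ≤ v_P(c)`;
* `PlaceOver.localRes_aeval_right` — the chain rule `res_P(a d p(x)) = res_P(a p'(x) dx)` for
  `p ∈ K[T]`.

These are the tools by which the genus of the levels of the Garcia–Stichtenoth tower is bounded
without differents (`2g - 2 = deg (dx₀)`): at each place one exhibits a local parameter `t` and the
conversion factor `c` with `dx₀ = c dt`.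

## References

* J. Tate, *Residues of differentials on curves*, Ann. Sci. ÉNS (4) 1 (1968) 149–159: §2 (R3)–(R4),
  §3 Thm. 2–3. [Tate1968]
* H. Stichtenoth, *Algebraic Function Fields and Codes*, 2nd ed., GTM 254 (2009): Def. 1.5.11,
  Prop. 1.5.13. [Stichtenoth2009]
-/

noncomputable section

open scoped Classical Polynomial
open Module Polynomial

namespace Literature.NumberTheory.DiophantineGeometry.AlgFunctionField

namespace PlaceOver

universe u v

variable {K : Type u} {F : Type v} [Field K] [Field F] [Algebra K F] [IsAlgFunctionField K F]

/-! ### Non-vanishing of `res_P(h t⁻¹ dt)` -/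

/-- **Non-vanishing**: over a finite constant field and for a local parameter `t` at `P`
(`v_P(t) = 1`) there is a unit `h ∈ 𝒪_P` with `res_P(h t⁻¹ dt) ≠ 0` — by the trace formula
`res_P(h t⁻¹ dt) = Tr_{F_P/K}(h̄)` and the surjectivity of the trace of the separable extension
`F_P/K`. [cite: Tate1968, §2, (R4)] -/
theorem exists_localRes_mul_inv_ne_zero [Finite K] (P : PlaceOver K F) {t : F} (ht : P.ord t = 1) :
    ∃ h : F, P.ord h = 0 ∧ P.localRes K (h * t⁻¹) t ≠ 0 := by
  haveI : FiniteDimensional K P.residueField := PlaceOver.finiteDimensional_residueField_holds P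
  haveI : PerfectField K := PerfectField.ofFinite
  have ht0 : t ≠ 0 := P.ne_zero_of_ord_ne_zero (by rw [ht]; exact one_ne_zero)
  obtain ⟨r, hr⟩ : ∃ r : P.residueField, Algebra.trace K P.residueField r ≠ 0 := by
    by_contra h
    push Not at h
    exact Algebra.trace_ne_zero K P.residueField (LinearMap.ext h)
  obtain ⟨h, rfl⟩ := IsLocalRing.residue_surjective r
  refine ⟨h, ?_, ?_⟩
  · have hunit : IsUnit h := by
      by_contra hnu
      apply hr
      rw [(IsLocalRing.residue_eq_zero_iff h).2 ((IsLocalRing.mem_maximalIdeal _).2 hnu), map_zero]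
    exact P.ord_eq_zero_of_isUnit h.2 hunit
  · rw [P.localRes_mul_inv_eq_ord_mul_trace h.2 ht0, ht, Int.cast_one, one_mul]
    exact hr

/-! ### Upper bounds on the divisor of `dy` -/

variable [IsIntegrallyClosedIn K F]

/-- **`res_P(a dy) ≠ 0` bounds `(dy)_P`**: then `dy ≠ 0` and `(dy)_P ≤ -v_P(a) - 1` (since `dy`
vanishes on `𝒜((dy))`, Stichtenoth Def. 1.5.11). [cite: Stichtenoth2009, Def. 1.5.11] -/
theorem differentialDivisor_le_of_localRes_ne_zero (P : PlaceOver K F) {a y : F}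
    (h : P.localRes K a y ≠ 0) :
    dOf K y ≠ 0 ∧ differentialDivisor (dOf K y) P ≤ -P.ord a - 1 := by
  have ha0 : a ≠ 0 := by rintro rfl; exact h (P.localRes_zero_left y)
  have hω : dOf K y ≠ 0 := by
    intro h0
    apply h
    rw [← dOf_single, h0]; rfl
  refine ⟨hω, ?_⟩
  by_contra hlt
  have hle : -P.ord a ≤ differentialDivisor (dOf K y) P := by omega
  have hmem : Adele.single P a ∈ adeleSubspace (differentialDivisor (dOf K y)) := by
    rw [single_mem_adeleSubspace_iff, P.valuation_le_zpow_iff_le_ord ha0]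
    omega
  have hωW := ((mem_weilDifferentialSpace_iff' _ _).1
    (mem_weilDifferentialSpace_differentialDivisor hω)).1
  have h0 := hωW _ hmem
  rw [dOf_single] at h0
  exact h h0

/-- **The local bound.** Let `t` be a local parameter at `P` and suppose `dy = c dt` at `P` in the
sense of residues: `res_P(a dy) = res_P(a c dt)` for all `a ∈ F`, with `c ≠ 0`. Then (over a finite
constant field) `dy ≠ 0` and `(dy)_P ≤ v_P(c)`: take `a = h c⁻¹ t⁻¹` with `Tr(h̄) ≠ 0`.
[cite: Stichtenoth2009, Prop. 1.5.13 and Def. 1.5.11] -/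
theorem differentialDivisor_dOf_le_ord [Finite K] (P : PlaceOver K F) {y t c : F} (ht : P.ord t = 1)
    (hc : c ≠ 0) (hconv : ∀ a : F, P.localRes K a y = P.localRes K (a * c) t) :
    dOf K y ≠ 0 ∧ differentialDivisor (dOf K y) P ≤ P.ord c := by
  obtain ⟨h, hh0, hres⟩ := P.exists_localRes_mul_inv_ne_zero ht
  have ht0 : t ≠ 0 := P.ne_zero_of_ord_ne_zero (by rw [ht]; exact one_ne_zero)
  have hne0 : h ≠ 0 := by
    rintro rfl
    rw [zero_mul, P.localRes_zero_left] at hres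
    exact hres rfl
  have key : P.localRes K (h * c⁻¹ * t⁻¹) y ≠ 0 := by
    rw [hconv, show h * c⁻¹ * t⁻¹ * c = h * t⁻¹ by field_simp]
    exact hres
  obtain ⟨hω, hle⟩ := P.differentialDivisor_le_of_localRes_ne_zero key
  refine ⟨hω, hle.trans ?_⟩
  rw [P.ord_mul_eq (mul_ne_zero hne0 (inv_ne_zero hc)) (inv_ne_zero ht0),
    P.ord_mul_eq hne0 (inv_ne_zero hc), P.ord_inv hc, P.ord_inv ht0, hh0, ht]
  omega

/-! ### The chain rule for polynomials -/

omit [IsIntegrallyClosedIn K F] in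
/-- **Chain rule** `res_P(a d p(x)) = res_P(a p'(x) dx)` for `p ∈ K[T]` (from the Leibniz rule and
`d(xⁿ) = n xⁿ⁻¹ dx`). [cite: Tate1968, §2, (R3)] -/
theorem localRes_aeval_right (P : PlaceOver K F) (a x : F) (p : K[X]) :
    P.localRes K a (aeval x p) = P.localRes K (a * aeval x (derivative p)) x := by
  induction p using Polynomial.induction_on' generalizing a with
  | add p q hp hq =>
    rw [map_add, P.localRes_add_right, hp, hq, map_add, map_add, mul_add, P.localRes_add_left]
  | monomial n c =>
    simp only [← C_mul_X_pow_eq_monomial, derivative_C_mul_X_pow, map_mul, map_pow, aeval_C, aeval_X,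
      map_natCast]
    rw [← Algebra.smul_def, P.localRes_smul_right]
    rcases n with _ | n
    · simp [P.localRes_zero_left]
    · rw [P.localRes_pow_right, Nat.add_sub_cancel,
        show a * (algebraMap K F c * ((n + 1 : ℕ) : F) * x ^ n) =
          c • (((n + 1 : ℕ) : K) • (a * x ^ n)) by
            rw [Algebra.smul_def, Algebra.smul_def, map_natCast]; ring,
        P.localRes_smul_left, P.localRes_smul_left]
      push_cast; ring

end PlaceOver

end Literature.NumberTheory.DiophantineGeometry.AlgFunctionField
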